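import Summits.BirchSwinnertonDyer.BirchSwinnertonDyer.Theorems.ByReductionTypeAtTwoTowerNoFiniteSubmoduleOfLayerPackage
import Summits.BirchSwinnertonDyer.Rank1Residual.Iwasawa.DivisiblePartsStationary
import Literature.NumberTheory.EllipticCurves.IwasawaNakayamaProofs
import HarnessLib

/-!
# Route `ByReductionTypeAtTwo`, TOWER road (items 19271 / 19573 / 19922 / 19923): the PRINT binder `h414`
# (Greenberg LNM 1716 Prop. 4.14 = `Greenberg1999.prop414_noFiniteSubmodule_of_not_dvd_torsionOrder`) on the
# HACHIMORI–MATSUNO ROAD — the STABILISATION of the divisible parts and their `conj_γ`-stability DISCHARGED;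
# displayed residue = exactly the Cassels–Tate layer pairings of [HachimoriMatsuno2000, p. 2540 L34–37]

HONEST FRAMING (cell `bsd-2adic`, run/shared/lean/pub/bsd-2adic/, seat `bsd-2adic-tower-1` GEN 22, HUMAN RULINGS D-0036 /
D-0054 / D-0074; D-0152: kernel hygiene on a CLASS-route hypothesis, no kit, no desk object): theorems only (no definition, no
named fact, no `sorry`, axioms the standard trio); CONDITIONAL on the displayed package; closes no route item; nothing booked;
BSD is not proved by any of this. `h414` stays displayed on the 429 K4 TOWER / λ-rank files; this file only SHRINKS, in the kernel,
the part of Hachimori–Matsuno's proof of it that is genuinely print.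

WHAT IT PROVES. Sequel of GEN 21's `TowerHaMa.SelmerDualData.forall_finite_eq_bot_of_towerPackage`
(`…TowerNoFiniteSubmoduleOfLayerPackage`), whose displayed package on the tree's plain Selmer tower
`Sel_{p^∞}(E/K_n) = W.selmerLayer κ n →(layerToInfty)→ W.selmerInfty κ` was: corestrictions realising the norm and adjoint to
restriction · subgroups `D_n` (`p`-divisible, `conj_γ`-stable) WITH A STABILISATION INDEX `m` (`res_∞(D_{n+1}) ⊆ res_∞(D_n)`, `n ≥ m`) ·
pairings with right kernel exactly `D_n` representing every character of `Sel(E/K_n)/D_n`, `conj_γ`-invariant. HERE (any number field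
`K`, any prime `p`, any `ℤ_p`-extension `κ` with topological generator `γ`, any dual datum `D` with `D.X` finitely generated and
`Λ`-torsion, `E(K)[p] = 0`):
* the subgroups `D_n` are no longer data — they are the RIGHT KERNELS of the displayed pairings;
* the stabilisation index and clause are GONE — PROVED from «`X` finitely generated and `Λ`-torsion» (Hachimori–Matsuno p. 2540:
  "Since `X` is `Λ`-torsion, the `ℤ_p`-corank of `D_n` is bounded as `n` varies") by cell `bsd-potss`' pure-algebra theorem
  `Rank1Residual.Iwasawa.forall_finite_eq_bot_of_selfDualLayers_of_isTorsion` (annihilators of divisible `Γ`-stable subgroups are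
  `p`-saturated `Λ`-submodules of bounded `ℤ_p`-corank; `SelmerDualData.isDualPair`);
* the `conj_γ`-stability of the right kernels is PROVED from the `conj_γ`-invariance of the pairing, and their compatibility with
  restriction `res(D_n) ⊆ D_{n+1}` from skew-symmetry + the res/cores adjointness.
What stays DISPLAYED is word for word [HachimoriMatsuno2000, p. 2540 L34–37]: "There exists a non-degenerate skew-symmetric
Galois-equivariant pairing `C_n × C_n → ℚ_p/ℤ_p` (cf. [Milne, ADT, Chap. I, §6]). Furthermore, the dual of the restriction map
`C_n → C_{n+1}` under this pairing is the corestriction map `C_{n+1} → C_n`", `C_n = Sel_{p^∞}(E/K_n)/D_n`, `D_n` the maximal divisible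
subgroup — as: biadditive pairings `⟨·,·⟩_n` on `Sel_{p^∞}(E/K_n)` lifted from `C_n` (so with `p`-DIVISIBLE right kernel and every
character vanishing on the right kernel represented = non-degeneracy on `C_n`), skew-symmetric, `conj_γ`-invariant, and corestrictions
`Sel(E/K_{n+1}) → Sel(E/K_n)` realising the norm `Σ_{i<p} conj_{γ^{pⁿ i}}` after restriction to `K_∞`, adjoint to `res_{K_{n+1}/K_n}`.

* §1 `SelmerDualData.forall_finite_eq_bot_of_casselsTatePackage` — the tree's layers, torsion datum, `E(K)[p] = 0`; displayed = the
  Cassels–Tate layer pairings + corestrictions only.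
* §2 `prop414_of_casselsTatePackages` — over `ℚ`: the Literature named fact `prop414_noFiniteSubmodule_of_not_dvd_torsionOrder`
  (binder `h414`) FOLLOWS from the displayed Cassels–Tate layer pairings for every globally minimal elliptic `W/ℚ`, prime `p` with
  `p ∤ #E(ℚ)_tors`, cyclotomic `κ`, topological generator `γ` (the fact's own hypotheses `[Module.Finite Λ D.X]`, `D.IsTorsion` now
  USED — they feed the stabilisation).

References: [HachimoriMatsuno2000] Y. Hachimori, K. Matsuno, Proc. AMS 128 (2000) 2539–2541, Theorem, Cor. (i) and proof
(p. 2540 L28–L45); [GreenbergLNM1716] §4 Prop. 4.14 (pp. 104–105); [MilneADT2006] I Prop. 6.9, Thm. 6.13, Rem. 6.10;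
[KitajimaOtsuki2018] Prop. 4.4, Thm. 4.5; [Washington1997] Prop. 13.28.
-/

set_option autoImplicit false
-- the Theorems namespace of this sub repeats the summit name by design (D-0017 nested layout: Summit.<S>.<Sub>)
set_option linter.dupNamespace false

noncomputable section

open scoped Classical

universe u

namespace Summit.BirchSwinnertonDyer.BirchSwinnertonDyer.Theorems.TowerHaMa

open NumberField IsDedekindDomain Field WeierstrassCurve Literature.NumberTheory.EllipticCurves
  Literature.NumberTheory.EllipticCurves.ZpExtension Literature.NumberTheory.GaloisRepresentations
  Summit.BirchSwinnertonDyer.Rank1Residual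

/-! ## §1 The tree's layers `Sel_{p^∞}(E/K_n)`, torsion dual datum: only the Cassels–Tate layer pairings displayed -/

section Tower

variable {K : Type u} [Field K] [NumberField K] (W : WeierstrassCurve K) [W.IsElliptic] {p : ℕ} [Fact p.Prime]
  (κ : ZpExtension K p) {γ : Field.absoluteGaloisGroup K}

/-- **Hachimori–Matsuno on the tree's plain Selmer tower, stabilisation discharged — only the Cassels–Tate layer pairings
displayed.** For ANY number field `K`, elliptic `W/K` with `E(K)[p] = 0` (`hK`), ANY `ℤ_p`-extension `κ` with topological generator
`γ`, ANY dual datum `D : W.SelmerDualData κ γ` with `D.X` finitely generated and `Λ`-torsion: if the layers `Sel_{p^∞}(E/K_n)`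
(`W.selmerLayer κ n`) carry biadditive pairings `⟨·,·⟩_n` which are skew-symmetric (`hskew`), `conj_γ`-invariant (`hinv`), with
`p`-divisible right kernel (`hdiv`) and every character vanishing on the right kernel represented (`hsurj`) — i.e. lifted from a
non-degenerate skew-symmetric Galois-equivariant pairing on `C_n = Sel(E/K_n)/D_n` —, together with corestrictions
`Sel(E/K_{n+1}) → Sel(E/K_n)` realising the norm `Σ_{i<p} conj_{γ^{pⁿ i}}` after restriction to `K_∞` and adjoint to `res_{K_{n+1}/K_n}`
(`hcores`), all pinned to the tree's maps `layerToInfty`, `resOfLe`, `conjH1` by their values — then `D.X` has no non-zero finite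
`Λ`-submodule. Supplied HERE (beyond GEN 21's injectivity / transitions / exhaustion / `Γ`-action): the right kernels `D_n` as the
subgroups of the package, their `conj_γ`-stability (invariance + surjectivity of `conj_γ` on the layer), `res(D_n) ⊆ D_{n+1}`
(skew-symmetry + adjointness), and the STABILISATION of `res_∞(D_n)` (`Λ`-torsion, via
`Iwasawa.forall_finite_eq_bot_of_selfDualLayers_of_isTorsion` and `SelmerDualData.isDualPair`).
[cite: HachimoriMatsuno2000, Theorem and Corollary (i), proof p. 2540 L28–L45]
[cite: MilneADT2006, I Prop. 6.9, Thm. 6.13 (a)(b), Rem. 6.10] [cite: GreenbergLNM1716, §4 Prop. 4.14 (pp. 104–105)] -/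
theorem SelmerDualData.forall_finite_eq_bot_of_casselsTatePackage (hγ : κ.IsTopGenerator γ)
    (hK : ∀ P : W.toAffine.Point, p • P = 0 → P = 0) (D : W.SelmerDualData κ γ)
    [Module.Finite (IwasawaAlgebra p) D.X] (htor : D.IsTorsion)
    (pair : ∀ n, W.selmerLayer κ n →+ W.selmerLayer κ n →+ AddCircle (1 : ℚ))
    (hskew : ∀ n (y t : W.selmerLayer κ n), pair n y t = -pair n t y)
    (hinv : ∀ n (y t y' t' : W.selmerLayer κ n),
      (y' : W.subgroupH1 p (κ.layerSubgroup n)) = W.conjH1 p (κ.layerSubgroup n) γ y →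
      (t' : W.subgroupH1 p (κ.layerSubgroup n)) = W.conjH1 p (κ.layerSubgroup n) γ t → pair n y' t' = pair n y t)
    (hdiv : ∀ n (t : W.selmerLayer κ n), (∀ y, pair n y t = 0) → ∃ t' : W.selmerLayer κ n, (∀ y, pair n y t' = 0) ∧ p • t' = t)
    (hsurj : ∀ n (g : W.selmerLayer κ n →+ AddCircle (1 : ℚ)),
      (∀ t, (∀ y, pair n y t = 0) → g t = 0) → ∃ c, ∀ y, g y = pair n y c)
    (hcores : ∀ n (t : W.selmerLayer κ (n + 1)), ∃ t' : W.selmerLayer κ n,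
      W.layerToInfty κ n t' =
        ∑ i ∈ Finset.range p, W.conjH1 p κ.kerSubgroup (γ ^ (p ^ n * i)) (W.layerToInfty κ (n + 1) t) ∧
      ∀ (y : W.selmerLayer κ n) (y' : W.selmerLayer κ (n + 1)),
        (y' : W.subgroupH1 p (κ.layerSubgroup (n + 1))) =
          W.resOfLe p (κ.layerSubgroup_antitone (Nat.le_succ n)) y → pair n y t' = pair (n + 1) y' t) :
    ∀ M : Submodule (IwasawaAlgebra p) D.X, Finite M → M = ⊥ := by
  -- the tree's layer data as additive maps (as in GEN 21's `forall_finite_eq_bot_of_towerPackage`)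
  let r : ∀ n, W.selmerLayer κ n →+ W.selmerInfty κ := fun n ↦
    ((W.layerToInfty κ n).comp (W.selmerLayer κ n).subtype).codRestrict (W.selmerInfty κ)
      fun x ↦ W.map_layerToInfty_selmerLayer_le_holds κ n ⟨x, x.2, rfl⟩
  have hr_coe : ∀ n (x : W.selmerLayer κ n),
      ((r n x : W.selmerInfty κ) : W.subgroupH1 p κ.kerSubgroup) = W.layerToInfty κ n x := fun _ _ ↦ rfl
  let ι : ∀ n, W.selmerLayer κ n →+ W.selmerLayer κ (n + 1) := fun n ↦
    ((W.resOfLe p (κ.layerSubgroup_antitone (Nat.le_succ n))).comp (W.selmerLayer κ n).subtype).codRestrict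
      (W.selmerLayer κ (n + 1)) fun x ↦ W.resOfLe_mem_selmerGroupOver p _ x.2
  have hι_coe : ∀ n (x : W.selmerLayer κ n), ((ι n x : W.selmerLayer κ (n + 1)) : W.subgroupH1 p (κ.layerSubgroup (n + 1))) =
      W.resOfLe p (κ.layerSubgroup_antitone (Nat.le_succ n)) x := fun _ _ ↦ rfl
  let γL : ∀ n, W.selmerLayer κ n →+ W.selmerLayer κ n := fun n ↦
    ((W.conjH1 p (κ.layerSubgroup n) γ).comp (W.selmerLayer κ n).subtype).codRestrict (W.selmerLayer κ n)
      fun x ↦ W.map_conjH1_selmerGroupOver_le_holds p (κ.layerSubgroup n) γ ⟨x, x.2, rfl⟩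
  have hγL_coe : ∀ n (x : W.selmerLayer κ n), ((γL n x : W.selmerLayer κ n) : W.subgroupH1 p (κ.layerSubgroup n)) =
      W.conjH1 p (κ.layerSubgroup n) γ x := fun _ _ ↦ rfl
  -- the right kernels of the displayed pairings
  let Dn : ∀ n, AddSubgroup (W.selmerLayer κ n) := fun n ↦
    { carrier := {t | ∀ y, pair n y t = 0}
      zero_mem' := fun y ↦ map_zero _
      add_mem' := fun {a b} ha hb y ↦ by rw [map_add, ha y, hb y, add_zero]
      neg_mem' := fun {a} ha y ↦ by rw [map_neg, ha y, neg_zero] }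
  have hDn : ∀ n (t : W.selmerLayer κ n), t ∈ Dn n ↔ ∀ y, pair n y t = 0 := fun _ _ ↦ Iff.rfl
  -- (a) injective layers (`E(K)[p] = 0`)
  have hr : ∀ n, Function.Injective (r n) := fun n x y h ↦
    Subtype.ext (layerToInfty_injective_of_no_pTorsion W κ hγ hK n (by rw [← hr_coe, ← hr_coe, h]))
  -- transitions over `Sel_∞`
  have hι : ∀ n (x : W.selmerLayer κ n), r (n + 1) (ι n x) = r n x := fun n x ↦ by
    apply Subtype.ext
    rw [hr_coe, hr_coe, hι_coe]
    exact congrArg (fun f ↦ f (x : W.subgroupH1 p (κ.layerSubgroup n)))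
      (W.resOfLe_comp_holds p (κ.kerSubgroup_le_layerSubgroup (n + 1)) (κ.layerSubgroup_antitone (Nat.le_succ n)))
  -- exhaustion
  have hex : ∀ s : W.selmerInfty κ, ∃ n, ∃ x : W.selmerLayer κ n, r n x = s := fun s ↦ by
    obtain ⟨n, y, hy, hys⟩ := (FineSelmerLeSignedSelmer.mem_selmerInfty_iff_exists_layer W κ
      (s : W.subgroupH1 p κ.kerSubgroup)).mp s.2
    exact ⟨n, ⟨y, hy⟩, Subtype.ext hys⟩
  -- the `Γ`-action on the layers over `conj_γ`
  have hγL : ∀ n (x : W.selmerLayer κ n), r n (γL n x) = W.conjSelmerInfty κ γ (r n x) := fun n x ↦ by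
    apply Subtype.ext
    rw [hr_coe, coe_conjSelmerInfty_apply, hr_coe, hγL_coe]
    exact congrArg (fun f ↦ f (x : W.subgroupH1 p (κ.layerSubgroup n)))
      (resOfLe_comp_conjH1_holds (M := geomPrimaryTorsion W p) (κ.kerSubgroup_le_layerSubgroup n) γ)
  have hγLs : ∀ n, Function.Surjective (γL n) := fun n y ↦ by
    refine ⟨⟨W.conjH1 p (κ.layerSubgroup n) γ⁻¹ y,
      W.map_conjH1_selmerGroupOver_le_holds p (κ.layerSubgroup n) γ⁻¹ ⟨y, y.2, rfl⟩⟩, Subtype.ext ?_⟩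
    rw [hγL_coe]
    change ((W.conjH1 p (κ.layerSubgroup n) γ).comp (W.conjH1 p (κ.layerSubgroup n) γ⁻¹)) _ = _
    rw [← W.conjH1_mul_holds p (κ.layerSubgroup n) γ γ⁻¹, mul_inv_cancel, W.conjH1_one_holds p (κ.layerSubgroup n),
      AddMonoidHom.id_apply]
  -- the displayed package, transported to the abstract shape
  have hinv' : ∀ n (y t : W.selmerLayer κ n), pair n (γL n y) (γL n t) = pair n y t :=
    fun n y t ↦ hinv n y t (γL n y) (γL n t) (hγL_coe n y) (hγL_coe n t)
  have hcores' : ∀ n (t : W.selmerLayer κ (n + 1)), ∃ t' : W.selmerLayer κ n,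
      r n t' = ∑ i ∈ Finset.range p, ((W.conjSelmerInfty κ γ) ^ (p ^ n * i)) (r (n + 1) t) ∧
      ∀ y : W.selmerLayer κ n, pair n y t' = pair (n + 1) (ι n y) t := fun n t ↦ by
    obtain ⟨t', ht', hadj⟩ := hcores n t
    refine ⟨t', Subtype.ext ?_, fun y ↦ hadj y (ι n y) (hι_coe n y)⟩
    rw [hr_coe, ht', AddSubmonoidClass.coe_finsetSum]
    exact Finset.sum_congr rfl fun i _ ↦ (W.coe_conjSelmerInfty_pow_apply κ γ (p ^ n * i) (r (n + 1) t)).symm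
  -- the right kernels: `p`-divisible, `conj_γ`-stable, restriction-compatible, exact, characters represented
  have hDdiv : ∀ n, ∀ d ∈ Dn n, ∃ d' ∈ Dn n, p • d' = d := fun n d hd ↦ by
    obtain ⟨d', hd', h⟩ := hdiv n d ((hDn n d).mp hd)
    exact ⟨d', (hDn n d').mpr hd', h⟩
  have hDγ : ∀ n, ∀ d ∈ Dn n, γL n d ∈ Dn n := fun n d hd ↦ by
    rw [hDn] at hd ⊢
    intro y
    obtain ⟨y₀, rfl⟩ := hγLs n y
    rw [hinv', hd y₀]
  have hDι : ∀ n, ∀ d ∈ Dn n, ι n d ∈ Dn (n + 1) := fun n d hd ↦ by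
    rw [hDn] at hd ⊢
    intro y'
    obtain ⟨c, _, hadj⟩ := hcores' n y'
    rw [hskew (n + 1), ← hadj d, hskew n, hd c, neg_zero, neg_zero]
  have hker : ∀ n (t : W.selmerLayer κ n), (∀ y, pair n y t = 0) → t ∈ Dn n := fun n t ht ↦ (hDn n t).mpr ht
  have hD0 : ∀ n, ∀ t ∈ Dn n, ∀ y, pair n y t = 0 := fun n t ht ↦ (hDn n t).mp ht
  have hsurj' : ∀ n (g : W.selmerLayer κ n →+ AddCircle (1 : ℚ)), (∀ d ∈ Dn n, g d = 0) →
      ∃ c, ∀ y, g y = pair n y c := fun n g hg ↦ hsurj n g fun t ht ↦ hg t ((hDn n t).mpr ht)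
  -- Hachimori–Matsuno WITHOUT stabilisation hypothesis (cell `bsd-potss`, `DivisiblePartsStationary`)
  exact Iwasawa.forall_finite_eq_bot_of_selfDualLayers_of_isTorsion p (W.conjSelmerInfty κ γ) r ι γL Dn pair D.toDual
    (D.isDualPair W hγ) htor hr hι hex hγL hγLs hcores' hDdiv hDγ hDι hker hD0 hsurj' hinv'

end Tower

/-! ## §2 Over `ℚ`: the binder `h414` from the displayed Cassels–Tate layer pairings -/

/-- **`h414` by the Hachimori–Matsuno road, stabilisation discharged.** If, for every globally minimal elliptic `W/ℚ`, every prime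
`p` with `p ∤ #E(ℚ)_tors`, every cyclotomic `κ` with topological generator `γ`, the plain Selmer layers `Sel_{p^∞}(E/ℚ_n)` carry the
Cassels–Tate layer pairings of §1 — [HachimoriMatsuno2000, p. 2540 L34–37]: skew-symmetric, Galois-equivariant, non-degenerate on
`C_n = Sel(E/ℚ_n)/D_n` (`p`-divisible right kernel, every character vanishing on it represented), the dual of restriction being the
corestriction (which realises the norm after restriction to `ℚ_∞`) — then the Literature named fact
`Greenberg1999.prop414_noFiniteSubmodule_of_not_dvd_torsionOrder` (Greenberg LNM 1716 Prop. 4.14, `F = ℚ`; the PRINT binder `h414` of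
the K4 TOWER doors) HOLDS. Injectivity of the layers (`p ∤ #E(ℚ)_tors` ⟹ `E(ℚ)[p] = 0`, Lagrange), transitions, exhaustion,
`Γ`-action, the divisible parts as right kernels, their `conj_γ`-stability and restriction-compatibility, and their STABILISATION
(from the fact's own hypotheses «`X` finitely generated, `Λ`-torsion») are proved in the kernel. CONDITIONAL; nothing asserted about
any curve. [cite: HachimoriMatsuno2000, Theorem and Corollary (i), proof p. 2540 L28–L45]
[cite: GreenbergLNM1716, §4 Prop. 4.14 (pp. 104–105)] [cite: MilneADT2006, I Prop. 6.9, Thm. 6.13, Rem. 6.10] -/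
theorem prop414_of_casselsTatePackages
    (hpack : ∀ (W : WeierstrassCurve ℚ) [W.IsElliptic] [W.IsGloballyMinimal] (p : ℕ) [Fact p.Prime],
      ¬ p ∣ W.torsionOrder →
      ∀ (κ : ZpExtension ℚ p) (γ : Field.absoluteGaloisGroup ℚ), κ.IsCyclotomic → κ.IsTopGenerator γ →
      ∃ pair : ∀ n, W.selmerLayer κ n →+ W.selmerLayer κ n →+ AddCircle (1 : ℚ),
      (∀ n (y t : W.selmerLayer κ n), pair n y t = -pair n t y) ∧
      (∀ n (y t y' t' : W.selmerLayer κ n),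
        (y' : W.subgroupH1 p (κ.layerSubgroup n)) = W.conjH1 p (κ.layerSubgroup n) γ y →
        (t' : W.subgroupH1 p (κ.layerSubgroup n)) = W.conjH1 p (κ.layerSubgroup n) γ t → pair n y' t' = pair n y t) ∧
      (∀ n (t : W.selmerLayer κ n), (∀ y, pair n y t = 0) →
        ∃ t' : W.selmerLayer κ n, (∀ y, pair n y t' = 0) ∧ p • t' = t) ∧
      (∀ n (g : W.selmerLayer κ n →+ AddCircle (1 : ℚ)),
        (∀ t, (∀ y, pair n y t = 0) → g t = 0) → ∃ c, ∀ y, g y = pair n y c) ∧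
      (∀ n (t : W.selmerLayer κ (n + 1)), ∃ t' : W.selmerLayer κ n,
        W.layerToInfty κ n t' =
          ∑ i ∈ Finset.range p, W.conjH1 p κ.kerSubgroup (γ ^ (p ^ n * i)) (W.layerToInfty κ (n + 1) t) ∧
        ∀ (y : W.selmerLayer κ n) (y' : W.selmerLayer κ (n + 1)),
          (y' : W.subgroupH1 p (κ.layerSubgroup (n + 1))) =
            W.resOfLe p (κ.layerSubgroup_antitone (Nat.le_succ n)) y → pair n y t' = pair (n + 1) y' t)) :
    Greenberg1999.prop414_noFiniteSubmodule_of_not_dvd_torsionOrder := by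
  intro W _ _ p _ htors κ γ hκ hγ D _ hD N hN
  obtain ⟨pair, hskew, hinv, hdiv, hsurj, hcores⟩ := hpack W p htors κ γ hκ hγ
  refine SelmerDualData.forall_finite_eq_bot_of_casselsTatePackage W κ hγ (fun P hP ↦ ?_) D hD pair hskew hinv hdiv hsurj
    hcores N hN
  -- `p ∤ #E(ℚ)_tors` ⟹ no rational point of order `p` (Lagrange in `E(ℚ)_tors`)
  by_contra hP0
  exact htors (dvd_torsionOrder_of_nsmul_eq_zero W p (by convert hP) hP0)

end Summit.BirchSwinnertonDyer.BirchSwinnertonDyer.Theorems.TowerHaMa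

end
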